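import Mathlib.Analysis.InnerProductSpace.Laplacian
import Mathlib.Analysis.Calculus.Deriv.Basic
import Mathlib.Analysis.Calculus.ContDiff.Basic
import Literature.Analysis.FluidPDE.VectorCalculus
import Literature.Analysis.FluidPDE.ClassicalSolution
import HarnessLib

/-!
# Classical Navier–Stokes / Euler solutions on a space–time region

Let `E` be a finite-dimensional real inner product space (`E = ℝ³` for the Clay statements) and
`Ω ⊆ ℝ × E` a set of space–time points `(t, x)` (time first, as everywhere in `FluidPDE`). A
*classical solution of the forced incompressible Navier–Stokes system with viscosity `ν` on `Ω`*
is a pair `(u, p)`, `u : ℝ → E → E`, `p : ℝ → E → ℝ`, whose uncurried fields are jointly `C^∞` on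
`Ω` and which satisfy `∂ₜu + (u·∇)u = νΔu − ∇p + f`, `div u = 0` at every `(t, x) ∈ Ω`. This is
the accepted slab predicate `Literature.Analysis.FluidPDE.IsClassicalNSSolutionOn S ν f u p` (the
case `Ω = S ×ˢ univ`) transported to arbitrary regions: moving exterior domains
`{(t, x) | 0 ≤ t < T, R t < ‖x‖}`, cylinders `S ×ˢ D` over a spatial (exterior) domain (Leray's
steady problem in a ball, flows past obstacles), parabolic cylinders of local regularity theory.

## Main definitions and statements (everything proved)

* `timeSection Ω x = {s | (s, x) ∈ Ω}`, `spaceSection Ω t = {x | (t, x) ∈ Ω}`.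
* `timeDerivOn Ω u t x = derivWithin (u · x) (timeSection Ω x) t`: the time derivative **within
  the region** — verbatim the slab convention `timeDerivWithin S` for `Ω = S ×ˢ univ`
  (`timeDerivOn_prod_univ`), the genuine `deriv (u · x) t` whenever the time section is a
  neighbourhood of `t`, in particular at every point of an open region
  (`timeDerivOn_of_mem_nhds`, `timeDerivOn_of_isOpen`), one-sided at an initial time in `Ω`.
* `IsClassicalNSSolutionOnRegion Ω ν f u p`: the structure with the four fields of the slab
  predicate (`smooth_velocity`, `smooth_pressure`, `momentum`, `divFree`);
  `IsClassicalEulerSolutionOnRegion Ω := … 0 …`.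
* bridge, for **every** time set `S`: `isClassicalNSSolutionOnRegion_prod_univ_iff :
  IsClassicalNSSolutionOnRegion (S ×ˢ univ) ν f u p ↔ IsClassicalNSSolutionOn S ν f u p`
  (directions `IsClassicalNSSolutionOn.onRegion`, `….isClassicalNSSolutionOn`);
* open regions: `isClassicalNSSolutionOnRegion_iff_of_isOpen` (momentum equation with the
  genuine `deriv`), `IsClassicalNSSolutionOnRegion.momentum_deriv`;
* monotonicity in `Ω`: `mono` (to any `Ω' ⊆ Ω` whose time sections are sets of unique
  differentiability at their points — the region form of the hypothesis `UniqueDiffOn ℝ S'` of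
  `IsClassicalNSSolutionOn.mono`), `mono_of_isOpen` (any open `Ω' ⊆ Ω`), `inter_of_isOpen`
  (`Ω ∩ O`, `O` open, no hypothesis on `Ω`), `IsClassicalNSSolutionOn.onRegion_inter` (a slab
  solution restricts to `(S ×ˢ univ) ∩ O`, e.g. to `{(t, x) | t ∈ S, R t < ‖x‖}`);
* cylinders and steady flows: `momentum_prod`, `IsClassicalNSSolutionOnRegion.of_steady`.

## Mathlib search

Mathlib (this pin) has no Navier–Stokes notions; the tree has the slab predicate (imported and
bridged here, not restated), its torus twin, and mild/weak/suitable notions, none on a general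
space–time region (searched `OnRegion`, `Region`, `exterior`, `timeSection`, `spaceSection`).
This file is a thin layer over `ContDiffOn`, `derivWithin`, `deriv`, `gradient`,
`InnerProductSpace.laplacian` and the accepted `convect`, `VectorCalculus.divergence`.

## Design notes

* `derivWithin` on the time section rather than `deriv`: (i) the slab predicate becomes literally
  the case `Ω = S ×ˢ univ` for every `S`, including the half-open slabs `Ico 0 T ×ˢ univ` of
  `HasSmoothExtensionPast` / `IsMaximalSmoothSolution`; (ii) the regions it is wanted for contain
  their initial time, where only a one-sided derivative is meaningful; (iii) on open regions
  nothing changes. The price is that of the slab predicate: restriction to a smaller region needs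
  unique differentiability of the smaller time sections (`mono`), automatic for open sets and for
  intersections with open sets. On a degenerate time section (an isolated instant) `derivWithin`
  is Mathlib's junk `0` — documented, never used by the intended regions.
* The spatial operators are the ambient ones of the slab predicate, so the predicate is meant for
  regions with open space sections (equations in the interior; boundary, junction, decay and
  initial conditions are separate hypotheses), exactly as on `S × E`. The force `f` is data: no
  regularity field (on an open region it is automatically smooth there).
* No declaration is put in a Mathlib namespace (`isOpen_timeSection`, not `IsOpen.timeSection`).

## References

* P. G. Lemarié-Rieusset, *The Navier–Stokes Problem in the 21st Century* (CRC, 2016), Def. 4.4,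
  p. 56 (classical solutions on a strip `(0, T) × ℝ³`).
* G. Seregin, *Lecture Notes on Regularity Theory for the Navier–Stokes Equations* (World
  Scientific, 2014), §4.7, Ch. 6 (the equations in space–time cylinders `Q = Ω × ]T₁, T₂[` and
  parabolic cylinders `Q(z₀, R) = B(x₀, R) × ]t₀ − R², t₀[`).
* G. P. Galdi, *An Introduction to the Mathematical Theory of the Navier–Stokes Equations:
  Steady-State Problems*, 2nd ed. (Springer, 2011), Ch. X (the steady exterior problem).
* J. T. Beale, T. Kato, A. Majda, *Remarks on the breakdown of smooth solutions for the 3-D Euler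
  equations*, Comm. Math. Phys. 94 (1984), §1 (classical solutions; the slab twin's source).
-/

noncomputable section

open Set Function Filter
open scoped ContDiff Laplacian Topology

namespace Literature.Analysis.FluidPDE

/-! ### Sections of a space–time region -/

section Sections

variable {X : Type*}

/-- The **time section** of a space–time region `Ω ⊆ ℝ × X` at the space point `x`:
`{s | (s, x) ∈ Ω}` (for a cylinder `S ×ˢ U` and `x ∈ U` it is `S`, `timeSection_prod`); a
preimage, so that Mathlib's `Set.preimage` API applies. [folklore] -/
def timeSection (Ω : Set (ℝ × X)) (x : X) : Set ℝ :=
  (fun s : ℝ => (s, x)) ⁻¹' Ω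

/-- The **space section** of a space–time region `Ω ⊆ ℝ × X` at time `t`: `{x | (t, x) ∈ Ω}`
(for a cylinder `S ×ˢ U` and `t ∈ S` it is `U`, `spaceSection_prod`). [folklore] -/
def spaceSection (Ω : Set (ℝ × X)) (t : ℝ) : Set X :=
  Prod.mk t ⁻¹' Ω

/-- Membership in a time section (definitional). [folklore] -/
@[simp]
theorem mem_timeSection {Ω : Set (ℝ × X)} {x : X} {s : ℝ} :
    s ∈ timeSection Ω x ↔ (s, x) ∈ Ω :=
  Iff.rfl

/-- Membership in a space section (definitional). [folklore] -/
@[simp]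
theorem mem_spaceSection {Ω : Set (ℝ × X)} {t : ℝ} {x : X} :
    x ∈ spaceSection Ω t ↔ (t, x) ∈ Ω :=
  Iff.rfl

/-- Time sections are monotone in the region. [folklore] -/
theorem timeSection_mono {Ω Ω' : Set (ℝ × X)} (h : Ω' ⊆ Ω) (x : X) :
    timeSection Ω' x ⊆ timeSection Ω x :=
  fun _ hs => h hs

/-- Space sections are monotone in the region. [folklore] -/
theorem spaceSection_mono {Ω Ω' : Set (ℝ × X)} (h : Ω' ⊆ Ω) (t : ℝ) :
    spaceSection Ω' t ⊆ spaceSection Ω t :=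
  fun _ hx => h hx

/-- The time section of an intersection is the intersection of the time sections
(definitional, Mathlib `Set.preimage_inter`). [folklore] -/
theorem timeSection_inter (Ω Ω' : Set (ℝ × X)) (x : X) :
    timeSection (Ω ∩ Ω') x = timeSection Ω x ∩ timeSection Ω' x :=
  rfl

/-- The time sections of a cylinder `S ×ˢ U` over points of `U` are `S`
(Mathlib `Set.mk_preimage_prod_left`). [folklore] -/
@[simp]
theorem timeSection_prod (S : Set ℝ) {U : Set X} {x : X} (hx : x ∈ U) :
    timeSection (S ×ˢ U) x = S :=
  mk_preimage_prod_left hx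

/-- The time sections of a slab `S ×ˢ univ` are all equal to `S`. [folklore] -/
@[simp]
theorem timeSection_prod_univ (S : Set ℝ) (x : X) : timeSection (S ×ˢ (univ : Set X)) x = S :=
  mk_preimage_prod_left (mem_univ x)

/-- The space sections of a cylinder `S ×ˢ U` over times in `S` are `U`
(Mathlib `Set.mk_preimage_prod_right`). [folklore] -/
@[simp]
theorem spaceSection_prod {S : Set ℝ} {t : ℝ} (ht : t ∈ S) (U : Set X) :
    spaceSection (S ×ˢ U) t = U :=
  mk_preimage_prod_right ht

variable [TopologicalSpace X]

/-- Time sections of an open region are open (preimage under `s ↦ (s, x)`). [folklore] -/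
theorem isOpen_timeSection {Ω : Set (ℝ × X)} (hΩ : IsOpen Ω) (x : X) :
    IsOpen (timeSection Ω x) :=
  hΩ.preimage (Continuous.prodMk_left x)

/-- Space sections of an open region are open (preimage under `x ↦ (t, x)`). [folklore] -/
theorem isOpen_spaceSection {Ω : Set (ℝ × X)} (hΩ : IsOpen Ω) (t : ℝ) :
    IsOpen (spaceSection Ω t) :=
  hΩ.preimage (Continuous.prodMk_right t)

/-- If `Ω` is a neighbourhood of `(t, x)`, its time section at `x` is a neighbourhood of `t`.
[folklore] -/
theorem timeSection_mem_nhds {Ω : Set (ℝ × X)} {t : ℝ} {x : X} (h : Ω ∈ 𝓝 (t, x)) :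
    timeSection Ω x ∈ 𝓝 t :=
  (Continuous.prodMk_left x).continuousAt.preimage_mem_nhds h

/-- If `Ω` is a neighbourhood of `(t, x)`, its space section at `t` is a neighbourhood of `x`.
[folklore] -/
theorem spaceSection_mem_nhds {Ω : Set (ℝ × X)} {t : ℝ} {x : X} (h : Ω ∈ 𝓝 (t, x)) :
    spaceSection Ω t ∈ 𝓝 x :=
  (Continuous.prodMk_right t).continuousAt.preimage_mem_nhds h

end Sections

/-! ### The time derivative within a region -/

section TimeDeriv

variable {X : Type*} {F : Type*} [NormedAddCommGroup F] [NormedSpace ℝ F]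

/-- The time derivative `∂ₜ u (t, x)` of `u : ℝ → X → F` **within the region `Ω`**: the
derivative of the time line `s ↦ u s x` within the time section `timeSection Ω x` (Mathlib
`derivWithin`). It is the slab convention `timeDerivWithin S` for `Ω = S ×ˢ univ`
(`timeDerivOn_prod_univ`), the genuine `deriv (u · x) t` whenever the time section is a
neighbourhood of `t` (`timeDerivOn_of_mem_nhds`, `timeDerivOn_of_isOpen`), and the one-sided
derivative at a time boundary belonging to `Ω`. Junk value `0` where `s ↦ u s x` is not
differentiable within the section (inherited from `derivWithin`). [folklore] -/
def timeDerivOn (Ω : Set (ℝ × X)) (u : ℝ → X → F) (t : ℝ) (x : X) : F :=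
  derivWithin (fun s => u s x) (timeSection Ω x) t

/-- Unfolding `timeDerivOn`. [folklore] -/
@[simp]
theorem timeDerivOn_apply (Ω : Set (ℝ × X)) (u : ℝ → X → F) (t : ℝ) (x : X) :
    timeDerivOn Ω u t x = derivWithin (fun s => u s x) (timeSection Ω x) t :=
  rfl

/-- On a cylinder `S ×ˢ U`, over points of `U`, the time derivative within the region is the
slab time derivative `timeDerivWithin S` of `ClassicalSolution`. [folklore] -/
theorem timeDerivOn_prod (S : Set ℝ) {U : Set X} (u : ℝ → X → F) (t : ℝ) {x : X}
    (hx : x ∈ U) : timeDerivOn (S ×ˢ U) u t x = timeDerivWithin S u t x := by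
  rw [timeDerivOn_apply, timeSection_prod S hx, timeDerivWithin_apply]

/-- On a slab `S ×ˢ univ` the time derivative within the region is **verbatim** the slab
convention `timeDerivWithin S u t x = derivWithin (u · x) S t`. [folklore] -/
@[simp]
theorem timeDerivOn_prod_univ (S : Set ℝ) (u : ℝ → X → F) (t : ℝ) (x : X) :
    timeDerivOn (S ×ˢ (univ : Set X)) u t x = timeDerivWithin S u t x :=
  timeDerivOn_prod S u t (mem_univ x)

/-- When the time section at `x` is a neighbourhood of `t`, the time derivative within the
region is the genuine partial derivative `deriv (u · x) t` (Mathlib `derivWithin_of_mem_nhds`).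
[folklore] -/
theorem timeDerivOn_of_mem_nhds {Ω : Set (ℝ × X)} (u : ℝ → X → F) {t : ℝ} {x : X}
    (h : timeSection Ω x ∈ 𝓝 t) : timeDerivOn Ω u t x = deriv (fun s => u s x) t :=
  derivWithin_of_mem_nhds h

/-- Intersecting the region with a set whose time section is a neighbourhood of `t` does not
change the time derivative at `(t, x)` (Mathlib `derivWithin_inter`; no unique-differentiability
hypothesis). [folklore] -/
theorem timeDerivOn_inter_of_mem_nhds {Ω O : Set (ℝ × X)} (u : ℝ → X → F) {t : ℝ} {x : X}
    (h : timeSection O x ∈ 𝓝 t) : timeDerivOn (Ω ∩ O) u t x = timeDerivOn Ω u t x := by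
  rw [timeDerivOn_apply, timeSection_inter, derivWithin_inter h, timeDerivOn_apply]

/-- At every point of an **open** region the time derivative within the region is the genuine
partial derivative `deriv (u · x) t` (Mathlib `derivWithin_of_isOpen`). [folklore] -/
theorem timeDerivOn_of_isOpen [TopologicalSpace X] {Ω : Set (ℝ × X)} (hΩ : IsOpen Ω)
    (u : ℝ → X → F) {t : ℝ} {x : X} (htx : (t, x) ∈ Ω) :
    timeDerivOn Ω u t x = deriv (fun s => u s x) t :=
  derivWithin_of_isOpen (isOpen_timeSection hΩ x) htx

variable [NormedAddCommGroup X] [NormedSpace ℝ X]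

/-- A field which is `Cⁿ`, `n ≠ 0`, jointly on `Ω` has time lines `s ↦ w s x` differentiable
within the time sections at the points of `Ω` (chain rule with `s ↦ (s, x)`, which maps
`timeSection Ω x` into `Ω`). [folklore] -/
theorem differentiableWithinAt_timeSection {Ω : Set (ℝ × X)} {w : ℝ → X → F} {n : WithTop ℕ∞}
    (h : ContDiffOn ℝ n (uncurry w) Ω) (hn : n ≠ 0) {t : ℝ} {x : X} (htx : (t, x) ∈ Ω) :
    DifferentiableWithinAt ℝ (fun s => w s x) (timeSection Ω x) t := by
  have h1 : DifferentiableWithinAt ℝ (uncurry w) Ω (t, x) :=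
    (h (t, x) htx).differentiableWithinAt hn
  have h2 : DifferentiableWithinAt ℝ (fun s : ℝ => ((s, x) : ℝ × X)) (timeSection Ω x) t :=
    differentiableWithinAt_id.prodMk (differentiableWithinAt_const _)
  exact h1.comp t h2 (mapsTo_preimage _ _)

/-- A field which is `Cⁿ` jointly on `Ω` has `Cⁿ` time slices `w t` on the space sections
(compose with `x ↦ (t, x)`). [folklore] -/
theorem contDiffOn_spaceSection {Ω : Set (ℝ × X)} {w : ℝ → X → F} {n : WithTop ℕ∞}
    (h : ContDiffOn ℝ n (uncurry w) Ω) (t : ℝ) : ContDiffOn ℝ n (w t) (spaceSection Ω t) :=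
  h.comp (contDiff_prodMk_right t).contDiffOn (mapsTo_preimage _ _)

/-- **Restriction of the time derivative.** For a field `Cⁿ` (`n ≠ 0`) jointly on `Ω` and a
smaller region `Ω' ⊆ Ω` whose time section at `x` is a set of unique differentiability at `t`,
the time derivatives within `Ω'` and within `Ω` agree at `(t, x) ∈ Ω'` (Mathlib
`HasDerivWithinAt.mono`, `HasDerivWithinAt.derivWithin`; the region form of
`IsSmoothSpaceTimeOn.timeDerivWithin_eq_of_subset`). [folklore] -/
theorem timeDerivOn_eq_of_subset {Ω Ω' : Set (ℝ × X)} {w : ℝ → X → F} {n : WithTop ℕ∞}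
    (h : ContDiffOn ℝ n (uncurry w) Ω) (hn : n ≠ 0) (hΩ' : Ω' ⊆ Ω) {t : ℝ} {x : X}
    (htx : (t, x) ∈ Ω') (hU : UniqueDiffWithinAt ℝ (timeSection Ω' x) t) :
    timeDerivOn Ω' w t x = timeDerivOn Ω w t x :=
  (((differentiableWithinAt_timeSection h hn (hΩ' htx)).hasDerivWithinAt).mono
    (timeSection_mono hΩ' x)).derivWithin hU

end TimeDeriv

/-! ### Classical solutions on a region -/

section Classical

variable {E : Type*} [NormedAddCommGroup E] [InnerProductSpace ℝ E] [FiniteDimensional ℝ E]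

/-- **Classical (smooth) solutions of the forced incompressible Navier–Stokes system with
viscosity `ν` on a space–time region `Ω ⊆ ℝ × E`**: `u` and `p` are jointly `C^∞` on `Ω`
(`ContDiffOn` of the uncurried fields) and, at every `(t, x) ∈ Ω`,
`∂ₜu + (u·∇)u = νΔu − ∇p + f` and `div u (t, x) = 0`, the time derivative being taken within
the region (`timeDerivOn`: the genuine `∂ₜ` at every point of an open region,
`isClassicalNSSolutionOnRegion_iff_of_isOpen`; one-sided at an initial time belonging to `Ω`).
The fields are those of the slab predicate `IsClassicalNSSolutionOn S` (Fefferman (1), (2), (6);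
Beale–Kato–Majda 1984, §1; Lemarié-Rieusset 2016, Def. 4.4), of which this is the literal
generalisation: `IsClassicalNSSolutionOnRegion (S ×ˢ univ) ν f u p ↔ IsClassicalNSSolutionOn S ν
f u p` for every `S` (`isClassicalNSSolutionOnRegion_prod_univ_iff`). Typical regions: moving
exterior domains `{(t, x) | 0 ≤ t < T, R t < ‖x‖}`, cylinders `S ×ˢ D` over an (exterior)
spatial domain (Galdi 2011, Ch. X; steady case `of_steady`), parabolic cylinders `Q(z₀, r)`
(Seregin 2014, Ch. 6). Meant for regions with open space sections (the spatial operators are the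
ambient `convect`, `gradient`, `Δ`, `divergence`); boundary, junction, decay and initial
conditions are separate hypotheses; the force `f` is data; Euler is `ν = 0`. [folklore] -/
structure IsClassicalNSSolutionOnRegion (Ω : Set (ℝ × E)) (ν : ℝ) (f u : ℝ → E → E)
    (p : ℝ → E → ℝ) : Prop where
  /-- The velocity is jointly smooth on `Ω`. -/
  smooth_velocity : ContDiffOn ℝ ∞ (uncurry u) Ω
  /-- The pressure is jointly smooth on `Ω`. -/
  smooth_pressure : ContDiffOn ℝ ∞ (uncurry p) Ω
  /-- The momentum equation `∂ₜu + (u·∇)u = νΔu − ∇p + f` holds at every point of `Ω`, with the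
  time derivative taken within `Ω`. -/
  momentum : ∀ t x, (t, x) ∈ Ω →
    timeDerivOn Ω u t x + convect (u t) (u t) x = ν • (Δ (u t)) x - gradient (p t) x + f t x
  /-- Incompressibility `div u (t, x) = 0` at every point of `Ω`. -/
  divFree : ∀ t x, (t, x) ∈ Ω → VectorCalculus.divergence (u t) x = 0

/-- Classical (smooth) solutions of the forced incompressible **Euler** equations on a space–time
region: `IsClassicalNSSolutionOnRegion` with `ν = 0` (cf. `IsClassicalEulerSolutionOn`).
[folklore] -/
abbrev IsClassicalEulerSolutionOnRegion (Ω : Set (ℝ × E)) (f u : ℝ → E → E) (p : ℝ → E → ℝ) :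
    Prop :=
  IsClassicalNSSolutionOnRegion Ω 0 f u p

variable {Ω Ω' : Set (ℝ × E)} {S : Set ℝ} {ν : ℝ} {f u : ℝ → E → E} {p : ℝ → E → ℝ}

/-- Euler solutions on a region are Navier–Stokes solutions with `ν = 0` (definitional).
[folklore] -/
theorem isClassicalEulerSolutionOnRegion_iff :
    IsClassicalEulerSolutionOnRegion Ω f u p ↔ IsClassicalNSSolutionOnRegion Ω 0 f u p :=
  Iff.rfl

/-! #### Bridge to the slab predicate `IsClassicalNSSolutionOn` -/

/-- A classical solution on the time set `S` (slab predicate of `ClassicalSolution`) is a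
classical solution on the region `S ×ˢ univ`: the smoothness fields coincide verbatim and the
time derivatives agree by `timeDerivOn_prod_univ`. [folklore] -/
theorem IsClassicalNSSolutionOn.onRegion (h : IsClassicalNSSolutionOn S ν f u p) :
    IsClassicalNSSolutionOnRegion (S ×ˢ univ) ν f u p where
  smooth_velocity := h.smooth_velocity
  smooth_pressure := h.smooth_pressure
  momentum t x htx := by
    rw [timeDerivOn_prod_univ]
    exact h.momentum t (mem_prod.1 htx).1 x
  divFree t x htx := h.divFree t (mem_prod.1 htx).1 x

/-- A classical solution on the slab region `S ×ˢ univ` is a classical solution on the time set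
`S` in the sense of `ClassicalSolution`. [folklore] -/
theorem IsClassicalNSSolutionOnRegion.isClassicalNSSolutionOn
    (h : IsClassicalNSSolutionOnRegion (S ×ˢ univ) ν f u p) :
    IsClassicalNSSolutionOn S ν f u p where
  smooth_velocity := h.smooth_velocity
  smooth_pressure := h.smooth_pressure
  momentum t ht x := by
    rw [← timeDerivOn_prod_univ]
    exact h.momentum t x (mk_mem_prod ht (mem_univ x))
  divFree t ht x := h.divFree t x (mk_mem_prod ht (mem_univ x))

/-- **Bridge.** On a slab `S ×ˢ univ` — for every time set `S`, open or not — the region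
predicate is equivalent to the accepted slab predicate `IsClassicalNSSolutionOn S ν f u p`.
[folklore] -/
theorem isClassicalNSSolutionOnRegion_prod_univ_iff :
    IsClassicalNSSolutionOnRegion (S ×ˢ univ) ν f u p ↔ IsClassicalNSSolutionOn S ν f u p :=
  ⟨IsClassicalNSSolutionOnRegion.isClassicalNSSolutionOn, IsClassicalNSSolutionOn.onRegion⟩

/-! #### Basic API -/

/-- The time slices `u t` of a classical solution are smooth on the space sections.
[folklore] -/
theorem IsClassicalNSSolutionOnRegion.contDiffOn_velocity
    (h : IsClassicalNSSolutionOnRegion Ω ν f u p) (t : ℝ) :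
    ContDiffOn ℝ ∞ (u t) (spaceSection Ω t) :=
  contDiffOn_spaceSection h.smooth_velocity t

/-- The time slices `p t` of the pressure are smooth on the space sections. [folklore] -/
theorem IsClassicalNSSolutionOnRegion.contDiffOn_pressure
    (h : IsClassicalNSSolutionOnRegion Ω ν f u p) (t : ℝ) :
    ContDiffOn ℝ ∞ (p t) (spaceSection Ω t) :=
  contDiffOn_spaceSection h.smooth_pressure t

/-- On an open region the velocity is smooth *at* every point of `Ω`. [folklore] -/
theorem IsClassicalNSSolutionOnRegion.contDiffAt_velocity
    (h : IsClassicalNSSolutionOnRegion Ω ν f u p) (hΩ : IsOpen Ω) {t : ℝ} {x : E}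
    (htx : (t, x) ∈ Ω) : ContDiffAt ℝ ∞ (uncurry u) (t, x) :=
  h.smooth_velocity.contDiffAt (hΩ.mem_nhds htx)

/-- On an open region the pressure is smooth *at* every point of `Ω`. [folklore] -/
theorem IsClassicalNSSolutionOnRegion.contDiffAt_pressure
    (h : IsClassicalNSSolutionOnRegion Ω ν f u p) (hΩ : IsOpen Ω) {t : ℝ} {x : E}
    (htx : (t, x) ∈ Ω) : ContDiffAt ℝ ∞ (uncurry p) (t, x) :=
  h.smooth_pressure.contDiffAt (hΩ.mem_nhds htx)

/-- On an **open** region the momentum equation holds with the genuine time derivative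
`∂ₜu (t, x) = deriv (u · x) t`. [folklore] -/
theorem IsClassicalNSSolutionOnRegion.momentum_deriv
    (h : IsClassicalNSSolutionOnRegion Ω ν f u p) (hΩ : IsOpen Ω) {t : ℝ} {x : E}
    (htx : (t, x) ∈ Ω) :
    deriv (fun s => u s x) t + convect (u t) (u t) x =
      ν • (Δ (u t)) x - gradient (p t) x + f t x := by
  rw [← timeDerivOn_of_isOpen hΩ u htx]
  exact h.momentum t x htx

/-- **Open regions.** For open `Ω` the predicate says exactly: `u`, `p` are `C^∞` on `Ω` and
`∂ₜu + (u·∇)u = νΔu − ∇p + f`, `div u = 0` hold at every point of `Ω` with the genuine partial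
time derivative. [folklore] -/
theorem isClassicalNSSolutionOnRegion_iff_of_isOpen (hΩ : IsOpen Ω) :
    IsClassicalNSSolutionOnRegion Ω ν f u p ↔
      ContDiffOn ℝ ∞ (uncurry u) Ω ∧ ContDiffOn ℝ ∞ (uncurry p) Ω ∧
        (∀ t x, (t, x) ∈ Ω → deriv (fun s => u s x) t + convect (u t) (u t) x =
          ν • (Δ (u t)) x - gradient (p t) x + f t x) ∧
        ∀ t x, (t, x) ∈ Ω → VectorCalculus.divergence (u t) x = 0 := by
  refine ⟨fun h => ⟨h.smooth_velocity, h.smooth_pressure,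
    fun t x htx => h.momentum_deriv hΩ htx, h.divFree⟩,
    fun h => ⟨h.1, h.2.1, fun t x htx => ?_, h.2.2.2⟩⟩
  rw [timeDerivOn_of_isOpen hΩ u htx]
  exact h.2.2.1 t x htx

/-- On a cylinder `S ×ˢ U` the momentum equation holds over `U` with the slab time derivative
`timeDerivWithin S` (one-sided at endpoints of `S`). [folklore] -/
theorem IsClassicalNSSolutionOnRegion.momentum_prod {U : Set E}
    (h : IsClassicalNSSolutionOnRegion (S ×ˢ U) ν f u p) {t : ℝ} (ht : t ∈ S) {x : E}
    (hx : x ∈ U) :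
    timeDerivWithin S u t x + convect (u t) (u t) x =
      ν • (Δ (u t)) x - gradient (p t) x + f t x := by
  rw [← timeDerivOn_prod S u t hx]
  exact h.momentum t x (mk_mem_prod ht hx)

/-! #### Monotonicity in the region -/

/-- **Restriction of the region.** A classical solution on `Ω` is a classical solution on every
`Ω' ⊆ Ω` whose time sections are sets of unique differentiability at their points (e.g. `Ω'`
open, `mono_of_isOpen`; `Ω ∩ O` with `O` open, `inter_of_isOpen`; cylinders over intervals).
The hypothesis is the region form of `UniqueDiffOn ℝ S'` in `IsClassicalNSSolutionOn.mono`: the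
time derivative within `Ω'` must agree with the one within `Ω` (`timeDerivOn_eq_of_subset`).
[folklore] -/
theorem IsClassicalNSSolutionOnRegion.mono (h : IsClassicalNSSolutionOnRegion Ω ν f u p)
    (hΩ' : Ω' ⊆ Ω)
    (hU : ∀ ⦃t : ℝ⦄ ⦃x : E⦄, (t, x) ∈ Ω' → UniqueDiffWithinAt ℝ (timeSection Ω' x) t) :
    IsClassicalNSSolutionOnRegion Ω' ν f u p where
  smooth_velocity := h.smooth_velocity.mono hΩ'
  smooth_pressure := h.smooth_pressure.mono hΩ'
  momentum t x htx := by
    rw [timeDerivOn_eq_of_subset h.smooth_velocity (by simp) hΩ' htx (hU htx)]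
    exact h.momentum t x (hΩ' htx)
  divFree t x htx := h.divFree t x (hΩ' htx)

/-- A classical solution on `Ω` is a classical solution on every **open** `Ω' ⊆ Ω`.
[folklore] -/
theorem IsClassicalNSSolutionOnRegion.mono_of_isOpen
    (h : IsClassicalNSSolutionOnRegion Ω ν f u p) (hΩ' : Ω' ⊆ Ω) (hO : IsOpen Ω') :
    IsClassicalNSSolutionOnRegion Ω' ν f u p :=
  h.mono hΩ' fun _ x htx => (isOpen_timeSection hO x).uniqueDiffWithinAt htx

/-- A classical solution on `Ω` is a classical solution on `Ω ∩ O` for every open `O`, with no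
hypothesis on `Ω` (Mathlib `derivWithin_inter`: intersecting with a neighbourhood does not
change `derivWithin`). [folklore] -/
theorem IsClassicalNSSolutionOnRegion.inter_of_isOpen
    (h : IsClassicalNSSolutionOnRegion Ω ν f u p) {O : Set (ℝ × E)} (hO : IsOpen O) :
    IsClassicalNSSolutionOnRegion (Ω ∩ O) ν f u p where
  smooth_velocity := h.smooth_velocity.mono inter_subset_left
  smooth_pressure := h.smooth_pressure.mono inter_subset_left
  momentum t x htx := by
    rw [timeDerivOn_inter_of_mem_nhds u ((isOpen_timeSection hO x).mem_nhds htx.2)]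
    exact h.momentum t x htx.1
  divFree t x htx := h.divFree t x htx.1

/-- A slab solution on the time set `S` restricts to a classical solution on `(S ×ˢ univ) ∩ O`
for every open `O ⊆ ℝ × E` — e.g. the moving exterior region `{(t, x) | t ∈ S ∧ R t < ‖x‖}` of
an outer problem (`O = {(t, x) | R t < ‖x‖}`, open for upper semicontinuous `R`). [folklore] -/
theorem IsClassicalNSSolutionOn.onRegion_inter (h : IsClassicalNSSolutionOn S ν f u p)
    {O : Set (ℝ × E)} (hO : IsOpen O) :
    IsClassicalNSSolutionOnRegion ((S ×ˢ univ) ∩ O) ν f u p :=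
  h.onRegion.inter_of_isOpen hO

/-! #### Steady solutions on a spatial domain -/

/-- **Steady flows.** Time-independent fields `U`, `P`, smooth on a spatial set `D` and solving
the steady system `(U·∇)U = νΔU − ∇P + F`, `div U = 0` at the points of `D` (Galdi 2011, Ch. X:
the steady exterior problem; Leray's problem in a ball), form a classical solution on the
cylinder `S ×ˢ D` for every time set `S` (the time derivative of a constant time line vanishes,
Mathlib `derivWithin_fun_const`). [folklore] -/
theorem IsClassicalNSSolutionOnRegion.of_steady {D : Set E} {U F : E → E} {P : E → ℝ}
    (hU : ContDiffOn ℝ ∞ U D) (hP : ContDiffOn ℝ ∞ P D)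
    (hmom : ∀ x ∈ D, convect U U x = ν • (Δ U) x - gradient P x + F x)
    (hdiv : ∀ x ∈ D, VectorCalculus.divergence U x = 0) (S : Set ℝ) :
    IsClassicalNSSolutionOnRegion (S ×ˢ D) ν (fun _ => F) (fun _ => U) fun _ => P where
  smooth_velocity := hU.comp contDiff_snd.contDiffOn fun _ htx => (mem_prod.1 htx).2
  smooth_pressure := hP.comp contDiff_snd.contDiffOn fun _ htx => (mem_prod.1 htx).2
  momentum t x htx := by
    simp only [timeDerivOn_apply, derivWithin_fun_const, Pi.zero_apply, zero_add]
    exact hmom x (mem_prod.1 htx).2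
  divFree t x htx := hdiv x (mem_prod.1 htx).2

end Classical

end Literature.Analysis.FluidPDE
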